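import Mathlib
import Literature.MathematicalPhysics.QuantumLattice.HeisenbergOrderNeelRiemann3
import HarnessLib

/-!
# Panel recipes bounding the envelope profile `1 − sin(2u)/(2u)`

Stub `stub_sinPanels` for the line *parity–multiplicity–commutator* of the crux
`GroundStateSimpleEven` (Weil ground state). The function `u ↦ 1 − sin(2u)/(2u)` is the profile
of the sharp envelope of `|ĝ(1/2+it)|²/(c‖g‖²)` for odd `g` supported in `[−c, c]` (`u = c|t|`);
the lead caps it by a step function whose constants are certified panel by panel with the eight
elementary recipes below (`a`, `b` are the panel ends, `x`/`z` a rational bound on the distance of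
`2u` to `π` or `2π`):

1. the polynomial cap `(2/3)u² − (2/15)u⁴ + (4/315)u⁶` (degree-7 Taylor minorant of `sin`);
2. positive-sine panels with `2u ∈ [x, π − x]`, where `sin(2u) ≥ sin x ≥ x − x³/6`;
3. negative-sine panels with `2u − π ∈ [0, x] ⊆ [0, π/2]`;
4. negative-sine panels with `2π − 2u ∈ [0, z] ⊆ [0, π/2]`;
5. the trivial cap `1 + 1/(2a)` (`sin ≥ −1`);
6. the straddling cap `1 + x/(2a)` (`sin y ≤ y` past `π`);
7. `sin(2u) ≥ 0` for `2u ∈ [32/5, 47/5] ⊆ [2π, 3π]`;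
8. the global cap `2` (`|sin y| ≤ |y|`).

All of them follow from the Taylor bounds for `sin`
(`KLSNumerics.sin_le_taylor_five`, `KLSNumerics.taylor_seven_le_sin`, `Real.sin_ge_sub_cube`,
`Real.sin_le`, `Real.abs_sin_le_abs`), the symmetries `sin (x − π) = −sin x`,
`sin (π − x) = sin x`, `sin (2π − x) = −sin x`, `sin (x − 2π) = sin x`, monotonicity of `sin` on
`[−π/2, π/2]` and the decimal brackets `3.14 < π < 3.15`.
-/

open Set MeasureTheory Filter

open scoped Real Topology

namespace Summit.RiemannHypothesis.RiemannHypothesis.Theorems.GroundStateSimpleEven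

set_option linter.dupNamespace false in
/-- Core step of the negative-sine recipes: if `−sin(2u) ≤ c` with `c ≥ 0` and `0 < a ≤ u`, then
`1 − sin(2u)/(2u) ≤ 1 + c/(2a)`. [folklore] -/
theorem sinPanels_core {a u c : ℝ} (ha : 0 < a) (hau : a ≤ u) (hc : 0 ≤ c)
    (h : -Real.sin (2 * u) ≤ c) : 1 - Real.sin (2 * u) / (2 * u) ≤ 1 + c / (2 * a) := by
  have h2u : 0 < 2 * u := by linarith
  have h1 : -Real.sin (2 * u) / (2 * u) ≤ c / (2 * u) := div_le_div_of_nonneg_right h h2u.le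
  have h2 : c / (2 * u) ≤ c / (2 * a) := div_le_div_of_nonneg_left hc (by linarith) (by linarith)
  rw [neg_div] at h1
  linarith

set_option linter.dupNamespace false in
/-- The quintic Taylor majorant `x − x³/6 + x⁵/120` of `sin` is nonnegative on `[0, π]` (it lies
above `sin x ≥ 0` there). [folklore] -/
theorem sinPanels_poly_nonneg {x : ℝ} (hx0 : 0 ≤ x) (hxpi : x ≤ π) :
    0 ≤ x - x ^ 3 / 6 + x ^ 5 / 120 := by
  have h1 := Literature.MathematicalPhysics.QuantumLattice.KLSNumerics.sin_le_taylor_five hx0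
  have h2 : 0 ≤ Real.sin x := Real.sin_nonneg_of_nonneg_of_le_pi hx0 hxpi
  linarith

set_option linter.dupNamespace false in
/-- Recipe 1 (polynomial cap near `0`): for `u > 0`,
`1 − sin(2u)/(2u) ≤ (2/3)u² − (2/15)u⁴ + (4/315)u⁶`, i.e. the degree-7 Taylor minorant
`y − y³/6 + y⁵/120 − y⁷/5040 ≤ sin y` at `y = 2u`, divided by `2u`. [folklore] -/
theorem sinPanels_taylor {u : ℝ} (hu : 0 < u) :
    1 - Real.sin (2 * u) / (2 * u) ≤ 2 / 3 * u ^ 2 - 2 / 15 * u ^ 4 + 4 / 315 * u ^ 6 := by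
  have h2u : 0 < 2 * u := by positivity
  have hT :=
    Literature.MathematicalPhysics.QuantumLattice.KLSNumerics.taylor_seven_le_sin h2u.le
  have key : 1 - (2 / 3 * u ^ 2 - 2 / 15 * u ^ 4 + 4 / 315 * u ^ 6) ≤
      Real.sin (2 * u) / (2 * u) := by
    rw [le_div_iff₀ h2u]
    have heq : (1 - (2 / 3 * u ^ 2 - 2 / 15 * u ^ 4 + 4 / 315 * u ^ 6)) * (2 * u) =
        2 * u - (2 * u) ^ 3 / 6 + (2 * u) ^ 5 / 120 - (2 * u) ^ 7 / 5040 := by ring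
    rw [heq]
    exact hT
  linarith

set_option linter.dupNamespace false in
/-- Recipe 2 (positive-sine panels below `π`): if `2u ∈ [2a, 2b] ⊆ [x, π − x]` with
`0 ≤ x ≤ π/2`, then `sin(2u) ≥ sin x ≥ x − x³/6 ≥ 0`, whence
`1 − sin(2u)/(2u) ≤ 1 − (x − x³/6)/(2b)`. [folklore] -/
theorem sinPanels_hump {a b x u : ℝ} (ha : 0 < a) (hau : a ≤ u) (hub : u ≤ b) (hx0 : 0 ≤ x)
    (hxpi : x ≤ π / 2) (hxa : x ≤ 2 * a) (hb : 2 * b ≤ π - x) :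
    1 - Real.sin (2 * u) / (2 * u) ≤ 1 - (x - x ^ 3 / 6) / (2 * b) := by
  have h2u : 0 < 2 * u := by linarith
  have h2b : 0 < 2 * b := by linarith
  have hsin : Real.sin x ≤ Real.sin (2 * u) := by
    rcases le_or_gt (2 * u) (π / 2) with h | h
    · exact Real.sin_le_sin_of_le_of_le_pi_div_two (by linarith [Real.pi_pos]) h (by linarith)
    · rw [← Real.sin_pi_sub (2 * u)]
      exact Real.sin_le_sin_of_le_of_le_pi_div_two (by linarith [Real.pi_pos]) (by linarith)
        (by linarith)
  have hcube : x - x ^ 3 / 6 ≤ Real.sin x := Real.sin_ge_sub_cube hx0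
  have hx2 : x ≤ 2 := by linarith [Real.pi_lt_d2]
  have hpoly : 0 ≤ x - x ^ 3 / 6 := by
    nlinarith [mul_nonneg (mul_nonneg hx0 hx0) (by linarith : (0 : ℝ) ≤ 2 - x),
      mul_nonneg hx0 (by linarith : (0 : ℝ) ≤ 3 - x)]
  have hs0 : 0 ≤ Real.sin (2 * u) := by linarith
  have h1 : (x - x ^ 3 / 6) / (2 * b) ≤ Real.sin (2 * u) / (2 * b) :=
    div_le_div_of_nonneg_right (by linarith) h2b.le
  have h2 : Real.sin (2 * u) / (2 * b) ≤ Real.sin (2 * u) / (2 * u) :=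
    div_le_div_of_nonneg_left hs0 h2u (by linarith)
  linarith

set_option linter.dupNamespace false in
/-- Recipe 3 (negative-sine panels just past `π`): if `π ≤ 2a ≤ 2u ≤ 2b ≤ π + x` with
`x ≤ π/2`, then `v := 2u − π ∈ [0, x]`, `sin(2u) = −sin v` and `0 ≤ sin v ≤ sin x ≤
x − x³/6 + x⁵/120`, whence `1 − sin(2u)/(2u) ≤ 1 + (x − x³/6 + x⁵/120)/(2a)`. [folklore] -/
theorem sinPanels_afterPi {a b x u : ℝ} (ha : 0 < a) (hau : a ≤ u) (hub : u ≤ b)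
    (hpa : π ≤ 2 * a) (hbx : 2 * b - π ≤ x) (hxpi : x ≤ π / 2) :
    1 - Real.sin (2 * u) / (2 * u) ≤ 1 + (x - x ^ 3 / 6 + x ^ 5 / 120) / (2 * a) := by
  have hv0 : 0 ≤ 2 * u - π := by linarith
  have hvx : 2 * u - π ≤ x := by linarith
  have hx0 : 0 ≤ x := hv0.trans hvx
  have hsin : Real.sin (2 * u) = -Real.sin (2 * u - π) := by
    rw [Real.sin_sub_pi, neg_neg]
  refine sinPanels_core ha hau (sinPanels_poly_nonneg hx0 (by linarith [Real.pi_pos])) ?_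
  rw [hsin, neg_neg]
  calc Real.sin (2 * u - π) ≤ Real.sin x :=
        Real.sin_le_sin_of_le_of_le_pi_div_two (by linarith [Real.pi_pos]) hxpi hvx
    _ ≤ x - x ^ 3 / 6 + x ^ 5 / 120 :=
        Literature.MathematicalPhysics.QuantumLattice.KLSNumerics.sin_le_taylor_five hx0

set_option linter.dupNamespace false in
/-- Recipe 4 (negative-sine panels just before `2π`): if `2a ≤ 2u ≤ 2b ≤ 2π` and
`2π − 2a ≤ z ≤ π/2`, then `w := 2π − 2u ∈ [0, z]`, `sin(2u) = −sin w` and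
`0 ≤ sin w ≤ sin z ≤ z − z³/6 + z⁵/120`, whence
`1 − sin(2u)/(2u) ≤ 1 + (z − z³/6 + z⁵/120)/(2a)`. [folklore] -/
theorem sinPanels_beforeTwoPi {a b z u : ℝ} (ha : 0 < a) (hau : a ≤ u) (hub : u ≤ b)
    (hb : 2 * b ≤ 2 * π) (haz : 2 * π - 2 * a ≤ z) (hzpi : z ≤ π / 2) :
    1 - Real.sin (2 * u) / (2 * u) ≤ 1 + (z - z ^ 3 / 6 + z ^ 5 / 120) / (2 * a) := by
  have hw0 : 0 ≤ 2 * π - 2 * u := by linarith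
  have hwz : 2 * π - 2 * u ≤ z := by linarith
  have hz0 : 0 ≤ z := hw0.trans hwz
  have hsin : Real.sin (2 * u) = -Real.sin (2 * π - 2 * u) := by
    rw [Real.sin_two_pi_sub, neg_neg]
  refine sinPanels_core ha hau (sinPanels_poly_nonneg hz0 (by linarith [Real.pi_pos])) ?_
  rw [hsin, neg_neg]
  calc Real.sin (2 * π - 2 * u) ≤ Real.sin z :=
        Real.sin_le_sin_of_le_of_le_pi_div_two (by linarith [Real.pi_pos]) hzpi hwz
    _ ≤ z - z ^ 3 / 6 + z ^ 5 / 120 :=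
        Literature.MathematicalPhysics.QuantumLattice.KLSNumerics.sin_le_taylor_five hz0

set_option linter.dupNamespace false in
/-- Recipe 5 (trivial cap): for `0 < a ≤ u`, `1 − sin(2u)/(2u) ≤ 1 + 1/(2a)` since
`sin ≥ −1`. [folklore] -/
theorem sinPanels_crude {a u : ℝ} (ha : 0 < a) (hau : a ≤ u) :
    1 - Real.sin (2 * u) / (2 * u) ≤ 1 + 1 / (2 * a) :=
  sinPanels_core ha hau zero_le_one (by linarith [Real.neg_one_le_sin (2 * u)])

set_option linter.dupNamespace false in
/-- Recipe 6 (straddling cap): if `0 < a ≤ u ≤ b`, `0 ≤ x` and `2b − π ≤ x`, then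
`−sin(2u) ≤ x` (it is `≤ 0` while `2u ≤ π`, and `= sin(2u − π) ≤ 2u − π ≤ x` afterwards), whence
`1 − sin(2u)/(2u) ≤ 1 + x/(2a)`. [folklore] -/
theorem sinPanels_linear {a b x u : ℝ} (ha : 0 < a) (hau : a ≤ u) (hub : u ≤ b) (hx0 : 0 ≤ x)
    (hbx : 2 * b - π ≤ x) : 1 - Real.sin (2 * u) / (2 * u) ≤ 1 + x / (2 * a) := by
  refine sinPanels_core ha hau hx0 ?_
  rcases le_or_gt (2 * u) π with h | h
  · have := Real.sin_nonneg_of_nonneg_of_le_pi (by linarith) h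
    linarith
  · have h1 : Real.sin (2 * u - π) ≤ 2 * u - π := Real.sin_le (by linarith)
    rw [Real.sin_sub_pi] at h1
    linarith

set_option linter.dupNamespace false in
/-- Recipe 7 (third hump): for `16/5 ≤ u ≤ 47/10` one has `2u − 2π ∈ [0, π]`
(`2π < 6.3 < 32/5`, `47/5 < 9.42 < 3π`), so `sin(2u) = sin(2u − 2π) ≥ 0` and
`1 − sin(2u)/(2u) ≤ 1`. [folklore] -/
theorem sinPanels_thirdHump {u : ℝ} (h1 : 16 / 5 ≤ u) (h2 : u ≤ 47 / 10) :
    1 - Real.sin (2 * u) / (2 * u) ≤ 1 := by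
  have h2u : 0 < 2 * u := by linarith
  have hs : 0 ≤ Real.sin (2 * u) := by
    rw [← Real.sin_sub_two_pi]
    exact Real.sin_nonneg_of_nonneg_of_le_pi (by linarith [Real.pi_lt_d2])
      (by linarith [Real.pi_gt_d2])
  have : 0 ≤ Real.sin (2 * u) / (2 * u) := div_nonneg hs h2u.le
  linarith

set_option linter.dupNamespace false in
/-- Recipe 8 (global cap): for `u > 0`, `|sin(2u)| ≤ 2u`, so `1 − sin(2u)/(2u) ≤ 2`.
[folklore] -/
theorem sinPanels_global {u : ℝ} (hu : 0 < u) : 1 - Real.sin (2 * u) / (2 * u) ≤ 2 := by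
  have h2u : 0 < 2 * u := by linarith
  have h := Real.abs_sin_le_abs (x := 2 * u)
  rw [abs_of_pos h2u] at h
  have h' : -Real.sin (2 * u) ≤ 2 * u := by linarith [neg_abs_le (Real.sin (2 * u))]
  have key : -Real.sin (2 * u) / (2 * u) ≤ 1 := by rwa [div_le_one h2u]
  rw [neg_div] at key
  linarith

end Summit.RiemannHypothesis.RiemannHypothesis.Theorems.GroundStateSimpleEven

namespace Summit.RiemannHypothesis.RiemannHypothesis.Theorems

set_option linter.dupNamespace false in
/-- **Panel recipes for the envelope profile `1 − sin(2u)/(2u)`.** In order: the polynomial cap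
`(2/3)u² − (2/15)u⁴ + (4/315)u⁶` (degree-7 Taylor minorant of `sin` at `2u`); positive-sine
panels with `2u ∈ [x, π − x]` (`sin(2u) ≥ sin x ≥ x − x³/6`); negative-sine panels with
`2u − π ∈ [0, x] ⊆ [0, π/2]`; negative-sine panels with `2π − 2u ∈ [0, z] ⊆ [0, π/2]`; the
trivial cap `1 + 1/(2a)`; the straddling cap `1 + x/(2a)` (`sin y ≤ y`); `sin(2u) ≥ 0` for
`2u ∈ [32/5, 47/5] ⊆ [2π, 3π]`; and the global cap `2` (`|sin y| ≤ |y|`). [folklore] -/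
theorem stub_sinPanels :
    (∀ u : ℝ, 0 < u → u ≤ 7 / 5 →
        1 - Real.sin (2 * u) / (2 * u) ≤ 2 / 3 * u ^ 2 - 2 / 15 * u ^ 4 + 4 / 315 * u ^ 6) ∧
      (∀ a b x u : ℝ, 0 < a → a ≤ u → u ≤ b → 0 ≤ x → x ≤ Real.pi / 2 → x ≤ 2 * a →
        2 * b ≤ Real.pi - x → 1 - Real.sin (2 * u) / (2 * u) ≤ 1 - (x - x ^ 3 / 6) / (2 * b)) ∧
      (∀ a b x u : ℝ, 0 < a → a ≤ u → u ≤ b → Real.pi ≤ 2 * a → 2 * b - Real.pi ≤ x →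
        x ≤ Real.pi / 2 →
          1 - Real.sin (2 * u) / (2 * u) ≤ 1 + (x - x ^ 3 / 6 + x ^ 5 / 120) / (2 * a)) ∧
      (∀ a b z u : ℝ, 0 < a → a ≤ u → u ≤ b → 3 * Real.pi / 2 ≤ 2 * a → 2 * b ≤ 2 * Real.pi →
        2 * Real.pi - 2 * a ≤ z → z ≤ Real.pi / 2 →
          1 - Real.sin (2 * u) / (2 * u) ≤ 1 + (z - z ^ 3 / 6 + z ^ 5 / 120) / (2 * a)) ∧
      (∀ a u : ℝ, 0 < a → a ≤ u → 1 - Real.sin (2 * u) / (2 * u) ≤ 1 + 1 / (2 * a)) ∧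
      (∀ a b x u : ℝ, 0 < a → a ≤ u → u ≤ b → 0 ≤ x → 2 * b - Real.pi ≤ x →
        1 - Real.sin (2 * u) / (2 * u) ≤ 1 + x / (2 * a)) ∧
      (∀ u : ℝ, 16 / 5 ≤ u → u ≤ 47 / 10 → 1 - Real.sin (2 * u) / (2 * u) ≤ 1) ∧
      (∀ u : ℝ, 0 < u → 1 - Real.sin (2 * u) / (2 * u) ≤ 2) :=
  ⟨fun _ hu _ ↦ GroundStateSimpleEven.sinPanels_taylor hu,
    fun _ _ _ _ ha hau hub hx0 hxpi hxa hb ↦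
      GroundStateSimpleEven.sinPanels_hump ha hau hub hx0 hxpi hxa hb,
    fun _ _ _ _ ha hau hub hpa hbx hxpi ↦
      GroundStateSimpleEven.sinPanels_afterPi ha hau hub hpa hbx hxpi,
    fun _ _ _ _ ha hau hub _ hb haz hzpi ↦
      GroundStateSimpleEven.sinPanels_beforeTwoPi ha hau hub hb haz hzpi,
    fun _ _ ha hau ↦ GroundStateSimpleEven.sinPanels_crude ha hau,
    fun _ _ _ _ ha hau hub hx0 hbx ↦ GroundStateSimpleEven.sinPanels_linear ha hau hub hx0 hbx,
    fun _ h1 h2 ↦ GroundStateSimpleEven.sinPanels_thirdHump h1 h2,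
    fun _ hu ↦ GroundStateSimpleEven.sinPanels_global hu⟩

end Summit.RiemannHypothesis.RiemannHypothesis.Theorems
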